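import Mathlib.Analysis.Calculus.ContDiff.Defs
import Mathlib.Analysis.Calculus.FDeriv.Basic
import Mathlib.Analysis.Calculus.Deriv.Basic
import Mathlib.Analysis.InnerProductSpace.PiL2
import Mathlib.Analysis.SpecialFunctions.Log.Basic
import Mathlib.MeasureTheory.Integral.Bochner.Basic
import Mathlib.MeasureTheory.Measure.Haar.OfBasis
import Mathlib.MeasureTheory.Measure.Haar.InnerProductSpace
import Mathlib.MeasureTheory.Measure.Prod
import Mathlib.Topology.Algebra.Support
import Literature.Analysis.FunctionSpaces.SobolevDomain
import HarnessLib

/-!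
# Barrier catalogue `AtomisticToContinuum` / `HydrodynamicLimit`: non-uniqueness of admissible
weak solutions of the multi-dimensional compressible Euler system ("wild solutions")

`Literature/Barriers/AtomisticToContinuum/WildSolutions.lean` (D-0021 barrier file; one barrier,
main declaration `WildSolutionsBarrier` carrying the structured BARRIER block).

## The result as printed (Markfelder 2021, LNM 2294)

Full compressible Euler system (1.6)–(1.8) in `ℝⁿ` for `(ρ, u, p)`,
`∂ₜρ + div(ρu) = 0`, `∂ₜ(ρu) + div(ρu ⊗ u) + ∇p = 0`,
`∂ₜ(½ρ|u|² + ρe) + div((½ρ|u|² + ρe + p)u) = 0`, ideal-gas incomplete equation of state (1.10)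
`e(ρ, p) = p/((γ-1)ρ)`, `γ > 1`, admissibility (1.16) `∂ₜ(ρZ(s)) + div(ρZ(s)u) ≥ 0` for all
`Z ∈ C^∞(ℝ)`, `Z' ≥ 0`, with the specific entropy (1.17) `s(ρ, p) = (log p - γ log ρ)/(γ-1)`.
**Definition 3.2.5** (`Ω = ℝ²`, `T = ∞`): `(ρ, u, p) ∈ L^∞((0,∞) × ℝ²; ℝ⁺ × ℝ² × ℝ⁺)`
(`ℝ⁺ = (0, ∞)`, p. 209) is a *weak solution* of (1.6)–(1.9) if (3.63)–(3.65) hold for all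
`(φ, w, ψ) ∈ C_c^∞([0,∞) × ℝ²; ℝ × ℝ² × ℝ)` (the book writes a bold `φ` for the vector test
function `w`):
(3.63) `∫₀^∞∫ [ρ∂ₜφ + ρu·∇φ] + ∫ ρ_init φ(0,·) = 0`;
(3.64) `∫₀^∞∫ [ρu·∂ₜw + ρu⊗u : ∇w + p div w] + ∫ ρ_init u_init·w(0,·) = 0`;
(3.65) `∫₀^∞∫ [(½ρ|u|² + ρe)∂ₜψ + (½ρ|u|² + ρe + p)u·∇ψ] + ∫ (½ρ_init|u_init|² + ρ_init e_init)ψ(0,·) = 0`;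
it is *admissible* if moreover (3.66)
`∫₀^∞∫ [ρZ(s)∂ₜφ + ρZ(s)u·∇φ] + ∫ ρ_init Z(s_init) φ(0,·) ≤ 0` for all `Z ∈ C^∞(ℝ)` with
`Z' ≥ 0` and all `φ ∈ C_c^∞([0,∞) × ℝ²; ℝ₀⁺)`.
Riemann data (8.1): `(ρ₋, u₋, p₋)` on `{y < 0}`, `(ρ₊, u₊, p₊)` on `{y > 0}`.
**Theorem 8.3.1** (= Al Baba–Klingenberg–Kreml–Mácha–Markfelder 2020): let `γ < 3` and
`ρ± > 0`, `u± ∈ ℝ²`, `p± > 0` with `u₋ = u₊ = 0` (first components) be such that the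
self-similar solution consists of a 1-shock and a 3-shock (possibly with a 2-contact), and
`v_M = 0`; then there exist infinitely many admissible weak solutions of (1.6)–(1.8), (8.1).
**Proposition 8.1.2**: with `u₋ = u₊`, two shocks iff (`p₋ ≤ p₊` and
`v₊ - v₋ < -√2 (p₊-p₋)/√(ρ₋((γ-1)p₋+(γ+1)p₊))`) or the symmetric condition.
**Theorem 8.3.4 (a)**: the constructed solutions have `(ρ, p) = (ρ̄, p̄)` piecewise constant
with values in `ℝ⁺` (only the velocity is "wild"). **Theorem 8.2.1 / Table 8.1**: whenever
the self-similar solution contains a shock the admissible weak solution is non-unique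
(infinitely many); uniqueness is known only for rarefaction-only patterns; contact-only
patterns are open. P. 62: "there are initial data for the full Euler system which lead to
infinitely many admissible ... weak solutions."

## Formal content

`FullEuler2D.IsAdmissibleWeakSolution γ (ρᵢ, uᵢ, pᵢ) (ρ, u, p)` renders Definition 3.2.5 on
`ℝ × ℝ²` (`ℝ² = EuclideanSpace ℝ (Fin 2)`, coordinates `x 0 = x`, `x 1 = y`): measurable,
essentially bounded fields, `ρ, p > 0` a.e. on `Γ = (0,∞) × ℝ²`, and (3.63)–(3.66) against
test functions taken as `C^∞` compactly supported functions on all of `ℝ × ℝ²`, with `∂ₜ`, `∂ⱼ`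
the Fréchet derivative in the directions `(1,0)`, `(0,eⱼ)`. Their restrictions are exactly
`C_c^∞([0,∞) × ℝ²)` by Seeley extension, so (3.63)–(3.65) are rendered verbatim; for the
NON-NEGATIVE class of (3.66) the restriction of non-negative global test functions is a smaller
class (a `φ ≥ 0` on `[0,∞) × ℝ²` with `φ(0,·) = 0 < ∂ₜφ(0,·)` has no non-negative smooth
extension), but for essentially bounded fields the two families of inequalities are equivalent
(apply the formal one to `φ(m_ε(t), x)χ(t)` with `m_ε ≥ 0` smooth, `m_ε(t) = t` for `t ≥ ε`,
and let `ε → 0` by dominated convergence). `WildSolutionsBarrier` is the instance of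
Theorem 8.3.1 for the explicit symmetric colliding data `ρ± = p± = 1`, `u₋ = (0, a)`,
`u₊ = (0, -a)`, `a > 0`, `1 < γ < 3` (two shocks by Proposition 8.1.2 with `p₋ = p₊`,
`v₊ - v₋ = -2a < 0`; `v_M = 0` by the reflection symmetry `y ↦ -y`, `v ↦ -v` of the data and
uniqueness of the self-similar solution, Proposition 8.1.1): there is a sequence of admissible
weak solutions, each with density and pressure essentially bounded below by a positive
constant (Theorem 8.3.4 (a)), with pairwise non-a.e.-equal velocity fields. Junk note: for
fields bounded away from vacuum and infinity every integrand in (3.63)–(3.66) is bounded and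
compactly supported, so all Bochner integrals below are proper; near vacuum `Z ∘ s` may fail
to be locally integrable and the printed definition has the same implicit finiteness proviso.
Not proved here (convex integration; an `XL` item).

## References

* S. Markfelder, *Convex Integration Applied to the Multi-Dimensional Compressible Euler
  Equations*, LNM 2294 (2021): (1.6)–(1.10), (1.16)–(1.17), Def. 3.2.5, Prop. 8.1.1–8.1.2,
  Thm 8.2.1 and Table 8.1, Thm 8.3.1, Thm 8.3.4, p. 62, p. 184, p. 209.
* H. Al Baba, C. Klingenberg, O. Kreml, V. Mácha, S. Markfelder, SIAM J. Math. Anal. 52 (2020)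
  1729–1760.
* E. Chiodaroli, C. De Lellis, O. Kreml, Comm. Pure Appl. Math. 68 (2015) 1157–1190.
* E. Chiodaroli, O. Kreml, V. Mácha, S. Schwarzacher, Trans. Amer. Math. Soc. 374 (2021)
  2269–2295.
* J. Březina, E. Feireisl, J. Math. Soc. Japan 70 (2018) (`DissipativeMVEuler.lean`).
-/

noncomputable section

open MeasureTheory Set

namespace Literature.Barriers.AtomisticToContinuum

namespace FullEuler2D

/-- Physical space `ℝ²` (coordinates `x 0 = x`, `x 1 = y`). [cite: Markfelder2021, Ch. 8 (8.1)] -/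
abbrev E2 : Type := EuclideanSpace ℝ (Fin 2)

/-- Space–time `ℝ × ℝ²` (time first). [cite: Markfelder2021, Def. 3.2.5] -/
abbrev SpaceTime : Type := ℝ × E2

/-- The space–time domain `Γ = (0, ∞) × ℝ²`. [cite: Markfelder2021, Def. 3.2.5] -/
def domain : Set SpaceTime := Ioi (0 : ℝ) ×ˢ univ

/-- Ideal-gas (incomplete) equation of state (1.10): `e(ρ, p) = p / ((γ - 1) ρ)`.
[cite: Markfelder2021, (1.10)] -/
def internalEnergy (γ ρ p : ℝ) : ℝ := p / ((γ - 1) * ρ)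

/-- Total energy density `½ ρ |u|² + ρ e(ρ, p)`. [cite: Markfelder2021, (1.8)] -/
def totalEnergy (γ ρ : ℝ) (u : E2) (p : ℝ) : ℝ := ρ * ‖u‖ ^ 2 / 2 + ρ * internalEnergy γ ρ p

/-- Specific entropy (1.17): `s(ρ, p) = (log p - γ log ρ)/(γ - 1)`. [cite: Markfelder2021, (1.17)] -/
def specificEntropy (γ ρ p : ℝ) : ℝ := (Real.log p - γ * Real.log ρ) / (γ - 1)

/-- Test functions: `C^∞` with compact support on `ℝ × ℝ²`, i.e. the tree's
`Literature.Analysis.FunctionSpaces.IsTestFunctionOn` on the whole space `⊤ : Opens SpaceTime` (restrictions to `[0,∞) × ℝ²`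
are the class `C_c^∞([0,∞) × ℝ²)` of Def. 3.2.5; for the non-negative class used in (3.66) see
the module docstring — equivalent constraints on essentially bounded fields). An `abbrev`, so the
tree's API (`Literature.Analysis.FunctionSpaces.isTestFunctionOn_zero`, `Literature.Analysis.FunctionSpaces.IsTestFunctionOn.mono`,
`TestFunction.isTestFunctionOn`) applies. [cite: Markfelder2021, Def. 3.2.5] -/
abbrev IsTestFunction {F : Type*} [NormedAddCommGroup F] [NormedSpace ℝ F] (φ : SpaceTime → F) :
    Prop :=
  Literature.Analysis.FunctionSpaces.IsTestFunctionOn (⊤ : TopologicalSpace.Opens SpaceTime) φ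

/-- Time derivative `∂ₜφ` of a space–time test function (Fréchet derivative in the direction
`(1, 0)`). [cite: Markfelder2021, Def. 3.2.5] -/
def dt {F : Type*} [NormedAddCommGroup F] [NormedSpace ℝ F] (φ : SpaceTime → F)
    (z : SpaceTime) : F :=
  fderiv ℝ φ z (1, 0)

/-- Spatial partial derivative `∂ⱼφ` (direction `(0, eⱼ)`). [cite: Markfelder2021, Def. 3.2.5] -/
def dx {F : Type*} [NormedAddCommGroup F] [NormedSpace ℝ F] (j : Fin 2) (φ : SpaceTime → F)
    (z : SpaceTime) : F :=
  fderiv ℝ φ z (0, EuclideanSpace.single j 1)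

/-- **Admissible weak solution of the full Euler system in `ℝ²` with ideal-gas law
(Markfelder Def. 3.2.5).** Data `(ρᵢ, uᵢ, pᵢ)` on `ℝ²`; unknowns `(ρ, u, p)` on `ℝ × ℝ²`
(only their values on `Γ = (0,∞) × ℝ²` matter): measurable and essentially bounded on `Γ`,
`ρ, p > 0` a.e. on `Γ`; the weak forms (3.63) mass, (3.64) momentum
(`ρu⊗u : ∇w = ∑ᵢⱼ ρ uᵢ uⱼ ∂ⱼwᵢ`, `div w = ∑ᵢ ∂ᵢwᵢ`), (3.65) energy, and the entropy
inequalities (3.66) for all smooth non-decreasing `Z` and non-negative test functions.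
[cite: Markfelder2021, Def. 3.2.5 with (1.10), (1.16)–(1.17)] -/
structure IsAdmissibleWeakSolution (γ : ℝ) (ρᵢ : E2 → ℝ) (uᵢ : E2 → E2) (pᵢ : E2 → ℝ)
    (ρ : SpaceTime → ℝ) (u : SpaceTime → E2) (p : SpaceTime → ℝ) : Prop where
  measurable_density : Measurable ρ
  measurable_velocity : Measurable u
  measurable_pressure : Measurable p
  essBounded : ∃ M : ℝ, ∀ᵐ z ∂(volume.restrict domain), |ρ z| ≤ M ∧ ‖u z‖ ≤ M ∧ |p z| ≤ M
  pos : ∀ᵐ z ∂(volume.restrict domain), 0 < ρ z ∧ 0 < p z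
  mass : ∀ φ : SpaceTime → ℝ, IsTestFunction φ →
    (∫ z in domain, (ρ z * dt φ z + ρ z * ∑ j, u z j * dx j φ z)) +
      ∫ x, ρᵢ x * φ (0, x) = 0
  momentum : ∀ w : SpaceTime → E2, IsTestFunction w →
    (∫ z in domain, (ρ z * ∑ i, u z i * dt w z i +
        ρ z * ∑ i, ∑ j, u z i * u z j * dx j w z i + p z * ∑ i, dx i w z i)) +
      ∫ x, ρᵢ x * ∑ i, uᵢ x i * w (0, x) i = 0
  energy : ∀ ψ : SpaceTime → ℝ, IsTestFunction ψ →
    (∫ z in domain, (totalEnergy γ (ρ z) (u z) (p z) * dt ψ z +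
        (totalEnergy γ (ρ z) (u z) (p z) + p z) * ∑ j, u z j * dx j ψ z)) +
      ∫ x, totalEnergy γ (ρᵢ x) (uᵢ x) (pᵢ x) * ψ (0, x) = 0
  entropy : ∀ Z : ℝ → ℝ, ContDiff ℝ (⊤ : ℕ∞) Z → (∀ r, 0 ≤ deriv Z r) →
    ∀ φ : SpaceTime → ℝ, IsTestFunction φ → (∀ z, 0 ≤ φ z) →
      (∫ z in domain, (ρ z * Z (specificEntropy γ (ρ z) (p z)) * dt φ z +
          ρ z * Z (specificEntropy γ (ρ z) (p z)) * ∑ j, u z j * dx j φ z)) +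
        ∫ x, ρᵢ x * Z (specificEntropy γ (ρᵢ x) (pᵢ x)) * φ (0, x) ≤ 0

/-- The symmetric colliding-streams Riemann velocity datum of strength `a`:
`u = (0, a)` on `{y < 0}` and `u = (0, -a)` on `{y ≥ 0}` (an instance of (8.1) with
`u₋ = u₊ = 0`, `v₋ = a`, `v₊ = -a`; the line `{y = 0}` is Lebesgue-null).
[cite: Markfelder2021, (8.1)] -/
def collidingStreams (a : ℝ) (x : E2) : E2 :=
  if x 1 < 0 then EuclideanSpace.single 1 a else EuclideanSpace.single 1 (-a)

end FullEuler2D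

open FullEuler2D

/-- **Barrier: past the first shock, admissible weak solutions of the multi-dimensional
compressible Euler system are not unique (convex integration), so no compactness +
admissibility argument can identify "the" limit, and weak–strong uniqueness ends with the strong
solution.**

Formal kernel (this `Prop`; the instance of Markfelder 2021 Thm 8.3.1 with Prop. 8.1.2 and
Thm 8.3.4 (a) for explicit symmetric two-shock data, not proved here): for every adiabatic
exponent `1 < γ < 3` and every `a > 0`, the Riemann data `ρ_init = p_init = 1`,
`u_init = collidingStreams a` admit a sequence `(ρₙ, uₙ, pₙ)` of admissible weak solutions of
the full Euler system in `ℝ²` (Def. 3.2.5), each with density and pressure essentially bounded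
below on `Γ = (0,∞) × ℝ²` by a positive constant, whose velocity fields are pairwise not
a.e. equal on `Γ` — infinitely many admissible weak solutions from data whose self-similar
solution consists of two shocks. [cite: Markfelder2021, Thm 8.3.1, Prop. 8.1.2, Thm 8.3.4 (a)] [cite: AlBabaEtAl2020, Thm 3.5 and Thm 4.2]

BARRIER
technique_class: weak-compactness measure-valued admissible-weak-solutions weak-strong-uniqueness relative-energy
blocks: any global-in-time (post-shock) strengthening of `HydrodynamicLimit` whose conclusion is convergence to "the admissible (entropy) weak solution", obtained by tightness of the empirical fields plus identification of limit points as admissible weak or dissipative measure-valued solutions (route DissipativeWeakStrong beyond the classical existence time): for the multi-dimensional full Euler system admissible weak solutions from Riemann data containing a shock are non-unique — infinitely many [cite: Markfelder2021, Thm 8.2.1 and Table 8.1, Thm 8.3.1] — and weak(measure-valued)–strong uniqueness selects the limit only while a strong (or rarefaction-only, piecewise `C¹`) solution exists [cite: Markfelder2021, pp. 161 and 187] [cite: BrezinaFeireisl2018, Thm 3.3]. The conjunct itself (up to the first shock) is not blocked.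
because: convex integration (De Lellis–Székelyhidi; fan subsolutions of Chiodaroli–De Lellis–Kreml) produces, from any admissible fan subsolution, infinitely many bounded velocity fields with prescribed density and pressure satisfying all balance laws and all entropy inequalities (1.16) [cite: Markfelder2021, Thm 8.3.4]; two-shock Riemann data admit such subsolutions for `γ < 3` (`c_v > 1/2`) [cite: Markfelder2021, Thm 8.3.1] [cite: AlBabaEtAl2020, Thm 3.5]; for the isentropic system with `p(ρ) = ρ²` there are Riemann data with infinitely many bounded admissible solutions [cite: ChiodaroliDeLellisKreml2015, Thm 1.1], hence Lipschitz (compression-wave) initial data with the same property [cite: ChiodaroliDeLellisKreml2015, Cor. 1.2], and even, for any prescribed `T > 0`, `C^∞` initial data whose infinitely many bounded admissible solutions on `(0, T + δ₀)` all coincide with the unique `C^∞` solution on `(0, T)` [cite: ChiodaroliKremlMachaSchwarzacher2021, Thm 1.1], so entropy admissibility does not restore uniqueness once shocks are present.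
evasions_known: (i) stay in the smooth regime (weak–strong uniqueness / relative energy) [cite: BrezinaFeireisl2018, Thm 3.3] [cite: Markfelder2021, p. 187]; (ii) rarefaction-only Riemann patterns are unique (Chen–Chen; Feireisl–Kreml–Vasseur) [cite: Markfelder2021, Thm 8.2.1 and Table 8.1]; (iii) stronger selection criteria: the entropy-rate (maximal dissipation) criterion rules out the constructed wild solutions in Feireisl's periodic barotropic example, without a well-posedness theorem [cite: Markfelder2021, p. 184]; (iv) one space dimension, where BV entropy solutions of small data are unique (Bressan et al.) [cite: Markfelder2021, §1.3 p. 26]. No selection principle singling out a unique admissible solution of multi-dimensional compressible Euler after shock formation is published [cite: Markfelder2021, §1.3 and Ch. 8].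
scope_caveats: (a) the formal Prop is ONE explicit instance of Thm 8.3.1 (`ρ± = p± = 1`, `u± = (0, ±a)`, ideal gas (1.10), `1 < γ < 3`) [cite: Markfelder2021, Thm 8.3.1 and Prop. 8.1.2]; the general two-shock data, the other non-unique patterns of Thm 8.2.1 / Table 8.1 and the isentropic Lipschitz/`C^∞` wild data are docstring citations only; (b) it lives on `ℝ²` with the ideal-gas law, whereas the conjunct `Literature.MathematicalPhysics.KineticTheory.HydrodynamicLimit` is on `𝕋³` with the hard-sphere equation of state — the transfer to periodic / three-dimensional / hard-sphere-EOS settings rests on citations only (Feireisl's periodic example reported at [cite: Markfelder2021, p. 184] is barotropic); (c) the conjunct as stated (up to the first shock) is not blocked — only post-shock strengthenings are; (d) admissibility here is Markfelder's `Z' ≥ 0` family of entropy inequalities (stricter than the single-`s` inequality of [cite: AlBabaEtAl2020, Def. 3.2]), and the Bochner rendering carries the integrability proviso of the module docstring (a non-integrable entropy integrand makes an inequality fail, not pass, so nothing beyond the source is admitted); (e) audit 2026-08-15 (refuter; companion `WildSolutionsNarrow.lean`, entry `WildSolutionsBarrierNarrow`): the kernel is confirmed verbatim against the source and its solution class is inhabited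 by the self-similar two-shock solution for every `γ > 1` (proved there), but the `technique_class` tokens `weak-strong-uniqueness relative-energy` are too broad — what is refuted is uniqueness in the `L^∞` admissible-weak / measure-valued class, whereas weighted, shifted relative entropy (a-contraction) against ONE planar target inside the class of vanishing-dissipation limits never uses that uniqueness and is in print past the smooth regime for the 3-D planar contact discontinuity [cite: KangVasseurWang2021, Abstract and Thm 1.1] (reported [cite: Markfelder2021, §8.5]) and for 1-D shocks [cite: KangVasseur2020, Abstract and Thm 1.1]; the data scope is sharpened there too (non-uniqueness is a theorem only for Riemann data with a shock and for specific compression-wave / dense-set data; the wild data of the known convex-integration ansätze for the full system are `L¹`-nowhere dense [cite: FeireislKlingenbergMarkfelder2020, Abstract, Thm 1.3 and Cor. 1.4]; planar shocks in `d ≥ 2` among vanishing-viscosity, kinetic or particle limits: open both ways).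
status: established (theorem in print); technique class narrowed 2026-08-15, see `WildSolutionsBarrierNarrow`
-/
def WildSolutionsBarrier : Prop :=
  ∀ γ a : ℝ, 1 < γ → γ < 3 → 0 < a →
    ∃ (ρ : ℕ → SpaceTime → ℝ) (u : ℕ → SpaceTime → E2) (p : ℕ → SpaceTime → ℝ),
      (∀ n, IsAdmissibleWeakSolution γ (fun _ => 1) (collidingStreams a) (fun _ => 1)
        (ρ n) (u n) (p n)) ∧
      (∀ n, ∃ m : ℝ, 0 < m ∧ ∀ᵐ z ∂(volume.restrict domain), m ≤ ρ n z ∧ m ≤ p n z) ∧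
      ∀ n n', n ≠ n' → ¬ (u n =ᵐ[volume.restrict domain] u n')

/-- Consequence: under `WildSolutionsBarrier`, for such data there are two admissible weak
solutions with essentially different velocity fields (non-uniqueness in its simplest form).
[cite: Markfelder2021, Thm 8.3.1] -/
theorem WildSolutionsBarrier.exists_two (h : WildSolutionsBarrier) {γ a : ℝ} (hγ : 1 < γ)
    (hγ' : γ < 3) (ha : 0 < a) :
    ∃ (ρ₁ ρ₂ : SpaceTime → ℝ) (u₁ u₂ : SpaceTime → E2) (p₁ p₂ : SpaceTime → ℝ),
      IsAdmissibleWeakSolution γ (fun _ => 1) (collidingStreams a) (fun _ => 1) ρ₁ u₁ p₁ ∧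
      IsAdmissibleWeakSolution γ (fun _ => 1) (collidingStreams a) (fun _ => 1) ρ₂ u₂ p₂ ∧
      ¬ (u₁ =ᵐ[volume.restrict domain] u₂) := by
  obtain ⟨ρ, u, p, hsol, -, hne⟩ := h γ a hγ hγ' ha
  exact ⟨ρ 0, ρ 1, u 0, u 1, p 0, p 1, hsol 0, hsol 1, hne 0 1 (by decide)⟩

/-- The colliding-streams datum takes only the two values `(0, ±a)`; in particular it is
bounded by `|a|` pointwise. [cite: Markfelder2021, (8.1)] -/
theorem norm_collidingStreams_le (a : ℝ) (x : E2) : ‖collidingStreams a x‖ ≤ |a| := by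
  unfold collidingStreams
  split_ifs <;> simp

end Literature.Barriers.AtomisticToContinuum

end
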